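import Literature.AlgebraicGeometry.Frobenioids.RealificationMapInjectiveFiniteSupp
import HarnessLib

/-!
# Frobenioids I, Def. 2.4 (i) / Prop. 5.3 — `f^rlf` is injective when the primes are pulled back
# disjointly and the divisors are COUNTABLY supported (row P53/L02a′ beyond finite support)

Mochizuki, *The geometry of Frobenioids I*, Kyushu J. Math. **62** (2008), Def. 2.4 (i) p. 48 (the
realification `M^rlf ⊆ ∏_𝔮 M^rlf_𝔮`), Prop. 5.3 p. 103 l. 12 ("the divisor monoid `Φ^rlf`")
[cite: MochizukiFrdI2008, Def. 2.4(i) p.48] [cite: MochizukiFrdI2008, Prop. 5.3 p.103].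

Context (cell abc-iut, layer L1, sub-DAG W3 row P53/L02a′ `FrdI.Prop53Sub.RlfMapInjective'`).  Seat
abc-iut-L1-d2 showed that `f ↦ f^rlf` does not preserve injectivity in general (P53-F1,
`RealificationMapNotInjective.lean`); seat abc-iut-w4-d084 showed that under the slot's disjointness
hypothesis the statement is undecidable for ARBITRARY perf-factorial `M` (a countably complete free
ultrafilter produces a counterexample, `RealificationMapInjectiveIndependence.lean`) and proved it for
FINITELY supported `M` (`IsPerfFactorial.Rlf.map_injective_of_disjoint_supp_of_finite`,
`RealificationMapInjectiveFiniteSupp.lean`).  This file closes the remaining case that matters for the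
divisor monoids of [EtTh] §3 (special fibres of tempered coverings: countably many irreducible components and
cusps, but infinitely supported divisors such as `div(q)`): **COUNTABLE support suffices.**

* `Realification.eq_one_of_forall_pow_dvd` — `P ⊗ ℝ_{≥0}` is archimedean: if every power `tⁿ` divides one
  fixed `u`, then `t = 0`.
* `IsPerfFactorial.Rlf.apply_eq_one_of_forall_restrict_of_finset` / **`…_of_countable`** — a homomorphism
  `φ : M^rlf → N^rlf` is "computed prime by prime" on countably supported elements: if every single-prime
  piece `φ(x|_𝔭)` vanishes at a prime `𝔯` of `N`, so does `φ(x)`.  (Enumerate `Supp(x) = {𝔮₀, 𝔮₁, …}`; the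
  head `x|_{𝔮₀,…,𝔮ₙ₋₁}` contributes nothing by the finite case; the tail `x_{≥ n}` satisfies
  `(x_{≥ n})ⁿ ≤ y := (x_𝔮^{i(𝔮)+1})_𝔮 ∈ M^rlf` for every `n`, so `φ(x)_𝔯ⁿ ≤ φ(y)_𝔯` for every `n` and
  the archimedean property of `N^rlf_𝔯 ≅ ℝ_{≥0}` forces `φ(x)_𝔯 = 0`.  No free countably complete
  ultrafilter lives on a countable set — this is the elementary shadow of that fact.)
* **`IsPerfFactorial.Rlf.eq_of_map_eq_of_countable`**, **`map_injective_of_disjoint_supp_of_countable`**,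
  `map_injective_of_disjoint_supp_of_countable_primes` — the slot's conclusion (`f^rlf` injective) under
  the slot's hypotheses (`f` injective; primary elements of distinct primes have disjointly supported images)
  plus ONLY "every element of `M^pf` has countable support" (in particular whenever `Prime(M^pf)` is
  countable).

Proof-only (no definitions); the upstream files are consumed by name.  Seat abc-iut-w5-d153 (gen 4).
Nothing here bears on [IUTchIII] Cor. 3.12 (L1 = [FrdI], a refereed preparatory paper); the consumer is
the binder `hBinj` of [EtTh] Def. 3.6 (i) at `Λ = ℝ` (`RealifiedDivisorMonoids.ofRlfR`).
-/

noncomputable section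

namespace Literature.AlgebraicGeometry.Frobenioids

open Function Literature.AnabelianGeometry.EtaleTheta

universe w

/-! ### `P ⊗ ℝ_{≥0}` is archimedean -/

/-- **`P ⊗ ℝ_{≥0}` is archimedean**: if `tⁿ ∣ u` for every `n`, then `t = 1` (additively: `n·t ≤ u` for
all `n` forces `t = 0`; evaluate at each functional `ℓ ∈ P^∨` and use that `ℝ_{≥0}` is archimedean).
[cite: MochizukiFrdI2008, §0 p.10] -/
theorem Realification.eq_one_of_forall_pow_dvd {P : Type w} [CommMonoid P] {t u : Realification P}
    (h : ∀ n : ℕ, t ^ n ∣ u) : t = 1 := by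
  have main : ∀ ℓ : RDual P, (show RDual P →* Multiplicative NNReal from t) ℓ = 1 := by
    intro ℓ
    by_contra hne
    have hne' : ((show RDual P →* Multiplicative NNReal from t) ℓ).toAdd ≠ 0 := by
      intro h0
      apply hne
      rw [← ofAdd_toAdd ((show RDual P →* Multiplicative NNReal from t) ℓ), h0, ofAdd_zero]
    obtain ⟨n, hn⟩ := exists_lt_nsmul (pos_iff_ne_zero.mpr hne')
      ((show RDual P →* Multiplicative NNReal from u) ℓ).toAdd
    obtain ⟨c, hc⟩ := h n
    have hc' : (show RDual P →* Multiplicative NNReal from u) =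
        (show RDual P →* Multiplicative NNReal from t) ^ n *
          (show RDual P →* Multiplicative NNReal from c) := hc
    have key := congrArg Multiplicative.toAdd (DFunLike.congr_fun hc' ℓ)
    rw [MonoidHom.mul_apply, MonoidHom.pow_apply, toAdd_mul, toAdd_pow] at key
    rw [key] at hn
    exact absurd hn (not_lt.mpr le_self_add)
  exact MonoidHom.ext main

namespace IsPerfFactorial

namespace Rlf

variable {M : Type w} [CommMonoid M] (hM : IsPerfFactorial M)
variable {N : Type w} [CommMonoid N] (hN : IsPerfFactorial N)

/-! ### Restrictions to one prime: bookkeeping -/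

/-- The `𝔭`-component of `x|_𝔭` is that of `x`. [cite: MochizukiFrdI2008, Def. 2.4(i) p.48] -/
theorem apply_restrict_same (𝔭 : Primes (Perfection M)) (x : hM.Rlf) :
    (hM.restrict 𝔭 x : RlfFactor M) 𝔭 = (x : RlfFactor M) 𝔭 := by
  rw [coe_restrict, single'_apply_same]

/-- `x|_𝔭` only depends on the `𝔭`-component of `x`. [cite: MochizukiFrdI2008, Def. 2.4(i) p.48] -/
theorem restrict_eq_restrict_of_apply_eq {𝔭 : Primes (Perfection M)} {x y : hM.Rlf}
    (h : (x : RlfFactor M) 𝔭 = (y : RlfFactor M) 𝔭) : hM.restrict 𝔭 x = hM.restrict 𝔭 y :=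
  Subtype.ext (by rw [coe_restrict, coe_restrict, h])

/-- `x|_𝔭 = 1` when the `𝔭`-component of `x` is trivial. [cite: MochizukiFrdI2008, Def. 2.4(i) p.48] -/
theorem restrict_eq_one_of_apply_eq_one {𝔭 : Primes (Perfection M)} {x : hM.Rlf}
    (h : (x : RlfFactor M) 𝔭 = 1) : hM.restrict 𝔭 x = 1 :=
  Subtype.ext (by rw [coe_restrict, h, single'_one, coe_one])

/-- Two elements of `M^rlf` with the same restrictions to every prime are equal.
[cite: MochizukiFrdI2008, Def. 2.4(i) p.48] -/
theorem eq_of_forall_restrict_eq {x y : hM.Rlf} (h : ∀ 𝔭, hM.restrict 𝔭 x = hM.restrict 𝔭 y) : x = y := by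
  apply Subtype.ext
  funext 𝔭
  rw [← apply_restrict_same hM 𝔭 x, ← apply_restrict_same hM 𝔭 y, h 𝔭]

/-- In a splitting `x = x|_𝔭 · x'`, the restrictions of `x'` to the other primes are those of `x`.
[cite: MochizukiFrdI2008, Def. 2.4(i) p.48] -/
theorem restrict_eq_of_eq_restrict_mul {𝔭 𝔮 : Primes (Perfection M)} {x x' : hM.Rlf}
    (hx : x = hM.restrict 𝔭 x * x') (hne : 𝔮 ≠ 𝔭) : hM.restrict 𝔮 x' = hM.restrict 𝔮 x := by
  apply restrict_eq_restrict_of_apply_eq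
  have h1 := congrArg (fun z : hM.Rlf => (z : RlfFactor M) 𝔮) hx
  simp only [coe_mul, Pi.mul_apply, coe_restrict, single'_apply_of_ne hne, one_mul] at h1
  exact h1.symm

/-- Any element of `M^rlf_factor` supported inside `Supp(x)`, `x ∈ M^rlf`, lies in `M^rlf`.
[cite: MochizukiFrdI2008, Def. 2.4(i) p.48] -/
theorem mem_realification_of_supp_subset {v : RlfFactor M} (x : hM.Rlf)
    (hv : supp v ⊆ supp (x : RlfFactor M)) : v ∈ hM.realification := by
  obtain ⟨b, hb⟩ := x.2
  exact ⟨b, hv.trans hb⟩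

/-! ### Homomorphisms out of `M^rlf` are computed prime by prime on countably supported elements -/

/-- **Finite case**: if `Supp(x) ⊆ s` (finite) and every `φ(x|_𝔭)`, `𝔭 ∈ s`, has trivial `𝔯`-component,
then so does `φ(x)` — induction on `s`, splitting off one prime at a time.
[cite: MochizukiFrdI2008, Prop. 5.3 p.103] -/
theorem apply_eq_one_of_forall_restrict_of_finset (φ : hM.Rlf →* hN.Rlf) (𝔯 : Primes (Perfection N))
    (s : Finset (Primes (Perfection M))) :
    ∀ x : hM.Rlf, supp (x : RlfFactor M) ⊆ ↑s →
      (∀ 𝔭 ∈ s, (φ (hM.restrict 𝔭 x) : RlfFactor N) 𝔯 = 1) → (φ x : RlfFactor N) 𝔯 = 1 := by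
  classical
  induction s using Finset.induction with
  | empty =>
    intro x hx _
    have hx1 : x = 1 := by
      by_contra hne
      obtain ⟨𝔮, h𝔮⟩ := (ne_one_iff_supp_nonempty hM x).mp hne
      simpa using hx h𝔮
    rw [hx1, map_one, coe_one, Pi.one_apply]
  | insert 𝔭 s h𝔭s ih =>
    intro x hx hres
    obtain ⟨x', hxx', hx'𝔭, hx's⟩ := exists_eq_restrict_mul hM x 𝔭
    have hx'sub : supp (x' : RlfFactor M) ⊆ ↑s := by
      intro 𝔮 h𝔮
      have h1 : 𝔮 ∈ insert 𝔭 s := by simpa using hx (hx's h𝔮)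
      rcases Finset.mem_insert.mp h1 with h2 | h2
      · subst h2
        exact (h𝔮 hx'𝔭).elim
      · simpa using h2
    have hres' : ∀ 𝔮 ∈ s, (φ (hM.restrict 𝔮 x') : RlfFactor N) 𝔯 = 1 := by
      intro 𝔮 h𝔮
      have hne : 𝔮 ≠ 𝔭 := by
        rintro rfl
        exact h𝔭s h𝔮
      rw [restrict_eq_of_eq_restrict_mul hM hxx' hne]
      exact hres 𝔮 (Finset.mem_insert_of_mem h𝔮)
    have h1 := hres 𝔭 (Finset.mem_insert_self _ _)
    rw [hxx', map_mul, coe_mul, Pi.mul_apply, h1, one_mul]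
    exact ih x' hx'sub hres'

/-- **Countable case ("no phantom contribution from the tail")**: for ANY homomorphism `φ : M^rlf → N^rlf`,
any `x ∈ M^rlf` with COUNTABLE support and any prime `𝔯` of `N^pf`: if every single-prime piece `φ(x|_𝔭)`
has trivial `𝔯`-component, then so does `φ(x)`.  Enumerate the support; the head is the finite case; the
tail `x_{≥n}` satisfies `(x_{≥n})ⁿ ∣ y` for the fixed element `y = (x_𝔮^{i(𝔮)+1})_𝔮 ∈ M^rlf`, whence
`φ(x)_𝔯ⁿ ∣ φ(y)_𝔯` for all `n`, and `N^rlf_𝔯` is archimedean. [cite: MochizukiFrdI2008, Prop. 5.3 p.103] -/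
theorem apply_eq_one_of_forall_restrict_of_countable (φ : hM.Rlf →* hN.Rlf) (𝔯 : Primes (Perfection N))
    (x : hM.Rlf) (hx : (supp (x : RlfFactor M)).Countable)
    (hres : ∀ 𝔭, (φ (hM.restrict 𝔭 x) : RlfFactor N) 𝔯 = 1) : (φ x : RlfFactor N) 𝔯 = 1 := by
  classical
  by_cases hx1 : x = 1
  · rw [hx1, map_one, coe_one, Pi.one_apply]
  obtain ⟨g, hg⟩ := hx.exists_eq_range ((ne_one_iff_supp_nonempty hM x).mp hx1)
  -- the index of a prime of the support in the enumeration `g`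
  have hex : ∀ 𝔮, 𝔮 ∈ supp (x : RlfFactor M) → ∃ i, g i = 𝔮 := by
    intro 𝔮 h𝔮
    rw [hg] at h𝔮
    exact h𝔮
  let idx : Primes (Perfection M) → ℕ := fun 𝔮 =>
    if h𝔮 : 𝔮 ∈ supp (x : RlfFactor M) then Nat.find (hex 𝔮 h𝔮) else 0
  have hidx : ∀ {𝔮}, 𝔮 ∈ supp (x : RlfFactor M) → g (idx 𝔮) = 𝔮 := by
    intro 𝔮 h𝔮
    simp only [idx, dif_pos h𝔮]
    exact Nat.find_spec (hex 𝔮 h𝔮)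
  have hidx_le : ∀ {𝔮} (i : ℕ), g i = 𝔮 → idx 𝔮 ≤ i := by
    intro 𝔮 i hi
    have h𝔮 : 𝔮 ∈ supp (x : RlfFactor M) := by
      rw [hg]
      exact ⟨i, hi⟩
    simp only [idx, dif_pos h𝔮]
    exact Nat.find_min' _ hi
  -- the dominating element `y = (x_𝔮 ^ (idx 𝔮 + 1))_𝔮`
  let yv : RlfFactor M := fun 𝔮 => (x : RlfFactor M) 𝔮 ^ (idx 𝔮 + 1)
  have hysupp : supp yv ⊆ supp (x : RlfFactor M) := by
    intro 𝔮 h𝔮 h1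
    exact h𝔮 (by simp only [yv, h1, one_pow])
  let y : hM.Rlf := ⟨yv, mem_realification_of_supp_subset hM x hysupp⟩
  -- heads and tails
  let headv : ℕ → RlfFactor M := fun n 𝔮 => if idx 𝔮 < n then (x : RlfFactor M) 𝔮 else 1
  let tailv : ℕ → RlfFactor M := fun n 𝔮 => if idx 𝔮 < n then 1 else (x : RlfFactor M) 𝔮
  have hheadsupp : ∀ n, supp (headv n) ⊆ supp (x : RlfFactor M) := by
    intro n 𝔮 h𝔮 h1
    exact h𝔮 (by simp only [headv, h1, ite_self])
  have htailsupp : ∀ n, supp (tailv n) ⊆ supp (x : RlfFactor M) := by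
    intro n 𝔮 h𝔮 h1
    exact h𝔮 (by simp only [tailv, h1, ite_self])
  let head : ℕ → hM.Rlf := fun n => ⟨headv n, mem_realification_of_supp_subset hM x (hheadsupp n)⟩
  let tail : ℕ → hM.Rlf := fun n => ⟨tailv n, mem_realification_of_supp_subset hM x (htailsupp n)⟩
  have hsplit : ∀ n, x = head n * tail n := by
    intro n
    apply Subtype.ext
    funext 𝔮
    change (x : RlfFactor M) 𝔮 = headv n 𝔮 * tailv n 𝔮
    by_cases h : idx 𝔮 < n
    · simp only [headv, tailv, if_pos h, mul_one]
    · simp only [headv, tailv, if_neg h, one_mul]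
  -- the head contributes nothing at `𝔯` (finite case)
  have hhead : ∀ n, (φ (head n) : RlfFactor N) 𝔯 = 1 := by
    intro n
    refine apply_eq_one_of_forall_restrict_of_finset hM hN φ 𝔯 ((Finset.range n).image g) (head n) ?_ ?_
    · intro 𝔮 h𝔮
      have hx𝔮 : 𝔮 ∈ supp (x : RlfFactor M) := hheadsupp n h𝔮
      have hlt : idx 𝔮 < n := by
        by_contra hlt
        exact h𝔮 (by simp only [head, headv, if_neg hlt])
      rw [Finset.coe_image, Finset.coe_range]
      exact ⟨idx 𝔮, hlt, hidx hx𝔮⟩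
    · intro 𝔭 _
      by_cases h : idx 𝔭 < n
      · have heq : (head n : RlfFactor M) 𝔭 = (x : RlfFactor M) 𝔭 := by simp only [head, headv, if_pos h]
        rw [restrict_eq_restrict_of_apply_eq hM heq]
        exact hres 𝔭
      · have heq : (head n : RlfFactor M) 𝔭 = 1 := by simp only [head, headv, if_neg h]
        rw [restrict_eq_one_of_apply_eq_one hM heq, map_one, coe_one, Pi.one_apply]
  -- hence `φ(x)_𝔯 = φ(tail n)_𝔯` for every `n`
  have htail : ∀ n, (φ (tail n) : RlfFactor N) 𝔯 = (φ x : RlfFactor N) 𝔯 := by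
    intro n
    conv_rhs => rw [hsplit n, map_mul, coe_mul, Pi.mul_apply, hhead n, one_mul]
  -- `(tail n)^n ∣ y` with an explicit cofactor in `M^rlf`
  have hdvd : ∀ n, tail n ^ n ∣ y := by
    intro n
    let cv : RlfFactor M := fun 𝔮 =>
      if idx 𝔮 < n then (x : RlfFactor M) 𝔮 ^ (idx 𝔮 + 1) else (x : RlfFactor M) 𝔮 ^ (idx 𝔮 + 1 - n)
    have hcsupp : supp cv ⊆ supp (x : RlfFactor M) := by
      intro 𝔮 h𝔮 h1
      apply h𝔮
      by_cases h : idx 𝔮 < n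
      · simp only [cv, if_pos h, h1, one_pow]
      · simp only [cv, if_neg h, h1, one_pow]
    refine ⟨⟨cv, mem_realification_of_supp_subset hM x hcsupp⟩, Subtype.ext ?_⟩
    funext 𝔮
    change yv 𝔮 = (tailv n ^ n * cv) 𝔮
    rw [Pi.mul_apply, Pi.pow_apply]
    by_cases h : idx 𝔮 < n
    · simp only [yv, tailv, cv, if_pos h, one_pow, one_mul]
    · simp only [yv, tailv, cv, if_neg h, ← pow_add]
      congr 1
      omega
  -- so every power of `t := φ(x)_𝔯` divides `φ(y)_𝔯` in the archimedean monoid `N^rlf_𝔯`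
  apply Realification.eq_one_of_forall_pow_dvd (u := (φ y : RlfFactor N) 𝔯)
  intro n
  obtain ⟨c, hc⟩ := hdvd n
  refine ⟨(φ c : RlfFactor N) 𝔯, ?_⟩
  rw [← htail n, ← Pi.pow_apply, ← Pi.mul_apply, ← coe_pow, ← coe_mul, ← map_pow, ← map_mul, ← hc]

/-! ### Injectivity of `f^rlf` on countably supported elements -/

/-- **`f^rlf x = f^rlf y ⇒ x = y` for countably supported `x, y ∈ M^rlf`** (`f` injective; primary elements of
distinct primes have disjointly supported images): at a prime `𝔯` in the support of the image of a primary
`p ∈ 𝔭`, the remainder `x'` of `x = x|_𝔭 · x'` contributes nothing (countable case above + disjointness), so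
`f^rlf(x|_𝔭) = f^rlf(y|_𝔭)`, whence `x|_𝔭 = y|_𝔭` for every `𝔭`. [cite: MochizukiFrdI2008, Prop. 5.3 p.103] -/
theorem eq_of_map_eq_of_countable {f : M →* N} (hf : Injective f)
    (hdisj : ∀ (𝔭 𝔮 : Primes (Perfection M)), 𝔭 ≠ 𝔮 → ∀ x ∈ 𝔭.carrier, ∀ y ∈ 𝔮.carrier,
      Disjoint (supp (hN.toRealification (Perfection.map f x) : RlfFactor N))
        (supp (hN.toRealification (Perfection.map f y) : RlfFactor N)))
    {x y : hM.Rlf} (hx : (supp (x : RlfFactor M)).Countable) (hy : (supp (y : RlfFactor M)).Countable)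
    (hxy : map hM hN f x = map hM hN f y) : x = y := by
  classical
  apply eq_of_forall_restrict_eq hM
  intro 𝔭
  apply restrict_eq_of_map_restrict_eq hM hN hf
  obtain ⟨⟨p, hp'⟩, hp⟩ := Quotient.exists_rep 𝔭
  have hpc : p ∈ 𝔭.carrier := ⟨hp', hp⟩
  -- the remainder of a countably supported element contributes nothing on `Supp(ι_N f^pf p)`
  have havoid : ∀ {z z' : hM.Rlf}, (supp (z : RlfFactor M)).Countable → z = hM.restrict 𝔭 z * z' →
      (z' : RlfFactor M) 𝔭 = 1 → supp (z' : RlfFactor M) ⊆ supp (z : RlfFactor M) →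
        ∀ 𝔯 ∈ supp (hN.toRealification (Perfection.map f p) : RlfFactor N),
          (map hM hN f z' : RlfFactor N) 𝔯 = 1 := by
    intro z z' hz hzz' hz'𝔭 hz's 𝔯 h𝔯
    refine apply_eq_one_of_forall_restrict_of_countable hM hN (map hM hN f) 𝔯 z' (hz.mono hz's) ?_
    intro 𝔮
    by_cases h𝔮𝔭 : 𝔮 = 𝔭
    · subst h𝔮𝔭
      rw [restrict_eq_one_of_apply_eq_one hM hz'𝔭, map_one, coe_one, Pi.one_apply]
    · obtain ⟨⟨q, hq'⟩, hq⟩ := Quotient.exists_rep 𝔮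
      have hqc : q ∈ 𝔮.carrier := ⟨hq', hq⟩
      by_contra hne
      have h1 := supp_map_restrict_subset hM hN f z' hqc hne
      exact Set.disjoint_left.mp (hdisj 𝔭 𝔮 (Ne.symm h𝔮𝔭) p hpc q hqc) h𝔯 h1
  obtain ⟨x', hxx', hx'𝔭, hx's⟩ := exists_eq_restrict_mul hM x 𝔭
  obtain ⟨y', hyy', hy'𝔭, hy's⟩ := exists_eq_restrict_mul hM y 𝔭
  apply Subtype.ext
  funext 𝔯
  have ex : ((map hM hN f x : hN.Rlf) : RlfFactor N) 𝔯 = ((map hM hN f y : hN.Rlf) : RlfFactor N) 𝔯 := by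
    rw [hxy]
  by_cases h𝔯 : 𝔯 ∈ supp (hN.toRealification (Perfection.map f p) : RlfFactor N)
  · rw [hxx', hyy', map_mul, map_mul, coe_mul, coe_mul, Pi.mul_apply, Pi.mul_apply,
      havoid hx hxx' hx'𝔭 hx's 𝔯 h𝔯, havoid hy hyy' hy'𝔭 hy's 𝔯 h𝔯, mul_one, mul_one] at ex
    exact ex
  · have h1 : ∀ z : hM.Rlf, (map hM hN f (hM.restrict 𝔭 z) : RlfFactor N) 𝔯 = 1 := by
      intro z
      by_contra hne
      exact h𝔯 (supp_map_restrict_subset hM hN f z hpc hne)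
    rw [h1 x, h1 y]

/-- **Slot `FrdI.Prop53Sub.RlfMapInjective'` for COUNTABLY SUPPORTED divisor monoids**: for perf-factorial
`M`, `N` with every `a ∈ M^pf` countably supported, a characteristically injective `f : M → N` under which
primary elements of distinct primes have images with disjoint supports in `N^rlf` induces an INJECTIVE
`f^rlf : M^rlf → N^rlf`.  (Only `Injective f` is used from `IsCharInjective f`.)
[cite: MochizukiFrdI2008, Prop. 5.3 p.103] -/
theorem map_injective_of_disjoint_supp_of_countable {f : M →* N} (hf : IsCharInjective f)
    (hdisj : ∀ (𝔭 𝔮 : Primes (Perfection M)), 𝔭 ≠ 𝔮 → ∀ x ∈ 𝔭.carrier, ∀ y ∈ 𝔮.carrier,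
      Disjoint (supp (hN.toRealification (Perfection.map f x) : RlfFactor N))
        (supp (hN.toRealification (Perfection.map f y) : RlfFactor N)))
    (hcnt : ∀ a : Perfection M, (supp (factorMap M a)).Countable) :
    Injective (map hM hN f) := by
  intro x y hxy
  obtain ⟨bx, hbx⟩ := x.2
  obtain ⟨by_, hby⟩ := y.2
  exact eq_of_map_eq_of_countable hM hN hf.1 hdisj ((hcnt bx).mono hbx) ((hcnt by_).mono hby) hxy

/-- The same when `Prime(M^pf)` itself is countable (e.g. the special fibre of a tempered covering has
countably many irreducible components and cusps). [cite: MochizukiFrdI2008, Prop. 5.3 p.103] -/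
theorem map_injective_of_disjoint_supp_of_countable_primes [Countable (Primes (Perfection M))]
    {f : M →* N} (hf : IsCharInjective f)
    (hdisj : ∀ (𝔭 𝔮 : Primes (Perfection M)), 𝔭 ≠ 𝔮 → ∀ x ∈ 𝔭.carrier, ∀ y ∈ 𝔮.carrier,
      Disjoint (supp (hN.toRealification (Perfection.map f x) : RlfFactor N))
        (supp (hN.toRealification (Perfection.map f y) : RlfFactor N))) :
    Injective (map hM hN f) :=
  map_injective_of_disjoint_supp_of_countable hM hN hf hdisj fun _ => Set.to_countable _

/-- Variant with plain injectivity of `f` (the only part of `IsCharInjective f` that is used) and countable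
`Prime(M^pf)`. [cite: MochizukiFrdI2008, Prop. 5.3 p.103] -/
theorem map_injective_of_injective_of_disjoint_supp_of_countable_primes [Countable (Primes (Perfection M))]
    {f : M →* N} (hf : Injective f)
    (hdisj : ∀ (𝔭 𝔮 : Primes (Perfection M)), 𝔭 ≠ 𝔮 → ∀ x ∈ 𝔭.carrier, ∀ y ∈ 𝔮.carrier,
      Disjoint (supp (hN.toRealification (Perfection.map f x) : RlfFactor N))
        (supp (hN.toRealification (Perfection.map f y) : RlfFactor N))) :
    Injective (map hM hN f) := fun _ _ hxy =>
  eq_of_map_eq_of_countable hM hN hf hdisj (Set.to_countable _) (Set.to_countable _) hxy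

end Rlf

end IsPerfFactorial

end Literature.AlgebraicGeometry.Frobenioids

end
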